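import Literature.NumberTheory.EllipticCurves.IsogenyTorsionFreeMemberProofs
import Literature.NumberTheory.EllipticCurves.TateModuleFree
import HarnessLib

/-!
# Every Galois-stable lattice of `T_pE` is the Tate module of an isogenous curve (Silverman *AEC* III.4.12 + III.7)

Topic `NumberTheory/EllipticCurves`; a proofs-only file (theorems only; no definitions, no
named facts, nothing restated).

THE STATEMENT. Let `E/K` be an elliptic curve over a perfect field `K`, `p` a prime, and
`L ⊆ T_pE` a `ℤ_p`-submodule which is stable under `Γ_K = Gal(K̄/K)` and contains `p^n T_pE`.
Then there are an elliptic curve `E'/K`, a `K`-isogeny `g : E → E'` (the quotient by the finite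
`Γ_K`-stable subgroup `Φ = L/p^nT_pE ⊆ E[p^n]`, Silverman *AEC* Prop. III.4.12 / Rem. III.4.13.2 —
the tree THEOREM `exists_isogeny_ker_eq_and_comp_eq_nsmul_holds`) and a `Γ_K`-equivariant
`ℤ_p`-linear isomorphism `e : L ≅ T_pE'` with `p^n · e = T_p(g)|_L`
(`WeierstrassCurve.exists_isogeny_tateModule_equiv_of_stableLattice`). Over `K = ℚ` the curve `E'`
may be taken globally minimal (`…_isGloballyMinimal_…`, Néron / *AEC* VIII.8.3 through the tree's
`hasGlobalMinimalModel_rat_holds`). In words: **every `Γ`-stable `ℤ_p`-lattice of `V_pE`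
commensurable with `T_pE` is the `p`-adic Tate module of a curve `K`-isogenous to `E`** — the
textbook fact behind "Kato's member" `E_K` of an isogeny class (the curve with
`T_pE_K ≅ V_{ℤ_p}(f)(1)`, Kato, Astérisque 295 (2004) 8.3 / 17.5; Wuthrich, Doc. Math. 19 (2014)
§3.2 p. 394 "it is crucial that we work with exactly the lattice `T = V_{ℤ_p}(f)(1)`"), recorded in
the `why it might fail` line of the BSD route item `ReducibleKatoMember` ("the node asserts `W_K` is
`ℚ`-isogenous to `W` … unproved when the Manin-type lattice is not a listed member").

THE PROOF (explicit on compatible sequences, no cardinality count). `Φ := pr_n(L) ⊆ E[p^n]` is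
finite and `Γ_K`-stable, and `L = pr_n⁻¹(Φ)` because `L ⊇ p^nT_pE = ker pr_n`. Let `g : E → E'`,
`f : E' → E` be the quotient isogeny and its dual: `ker g = Φ`, `f∘g = [N]`, `g∘f = [N]`,
`N = #Φ = p^a` (`Φ` has exponent `p^n`). Define `Θ : L → T_pE'`, `Θ(l)_k := g(l_{k+n})` — a
compatible sequence since `p^k l_{k+n} = l_n ∈ Φ = ker g`. Then `p^n Θ(l) = T_p(g)(l)`, so `Θ`
is `ℤ_p`-linear (`T_pE'` has no `p`-torsion); `Θ` is `Γ_K`-equivariant because `g` is; `Θ(l) = 0`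
forces `l_{k+n} ∈ Φ ⊆ E[p^n]`, i.e. `l_k = p^n l_{k+n} = 0`; and `Θ` is onto: for `s ∈ T_pE'` the
sequence `l_k := f(p^n s_{k+a})` lies in `T_pE` (its `p^k`-multiple is `f` of an element of
`E'[p^{a−n}] ⊆ ker f`, as `g` is onto `E'(K̄)`), in `L` (`l_n = f(s_a)` and `g f(s_a) = p^a s_a = 0`),
and `Θ(l)_k = g f(p^n s_{k+n+a}) = p^{a+n} s_{k+n+a} = s_k`.

References: J. H. Silverman, *AEC* (GTM 106, 2009) Prop. III.4.12, Rem. III.4.13.2, Thm. III.6.1,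
III.§7, Cor. VIII.8.3 [SilvermanAEC2009]; K. Kato, Astérisque 295 (2004) 8.3, 17.5
[Kato2004Asterisque]; C. Wuthrich, Doc. Math. 19 (2014) §3.2 [Wuthrich2014].
-/

noncomputable section

open scoped Classical

universe u

namespace Literature.NumberTheory.EllipticCurves

open _root_.WeierstrassCurve Field

/-! ## A Tate-module lemma -/

namespace TateModule

variable {A : Type u} [AddCommGroup A] {p : ℕ}

variable [Fact p.Prime]

/-- Cancellation of `p^n` in `T_p A` (no `p`-torsion). [folklore] -/
private theorem pow_smul_right_cancel {n : ℕ} {a b : TateModule A p}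
    (h : (p : ℤ_[p]) ^ n • a = (p : ℤ_[p]) ^ n • b) : a = b := by
  rw [← sub_eq_zero] at h ⊢
  rw [← smul_sub] at h
  exact eq_zero_of_pow_smul_eq_zero h

end TateModule

/-! ## The construction -/

section Construction

variable {K : Type u} [Field K] [PerfectField K] (W : WeierstrassCurve K) [W.IsElliptic]
  (p : ℕ) [hp : Fact p.Prime]

/-- **Every `Γ_K`-stable `ℤ_p`-lattice `p^nT_pE ⊆ L ⊆ T_pE` is the Tate module of a
`K`-isogenous curve.** For an elliptic curve `E/K` (`K` perfect), a prime `p`, and a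
`ℤ_p`-submodule `L ⊆ T_pE` stable under `Γ_K` with `p^n T_pE ⊆ L`: there are an elliptic curve
`E'/K`, a `K`-isogeny `g : E → E'` with kernel `pr_n(L) ⊆ E[p^n]`, and a `ℤ_p`-linear isomorphism
`e : L ≅ T_pE'` which is `Γ_K`-equivariant and satisfies `p^n · e(l) = T_p(g)(l)`.
(Silverman *AEC* Prop. III.4.12 / Rem. III.4.13.2 for the quotient, III.§7 for `T_p`.)
[cite: SilvermanAEC2009, Prop. III.4.12 with Rem. III.4.13.2, and III.7] -/
theorem _root_.WeierstrassCurve.exists_isogeny_tateModule_equiv_of_stableLattice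
    (L : Submodule ℤ_[p] (W.tateModule p))
    (hGal : ∀ (σ : absoluteGaloisGroup K) (a : W.tateModule p), a ∈ L → σ • a ∈ L)
    {n : ℕ} (hn : ∀ a : W.tateModule p, (p : ℤ_[p]) ^ n • a ∈ L) :
    ∃ (W' : WeierstrassCurve K) (_ : W'.IsElliptic) (g : Isogeny W W')
      (e : L ≃ₗ[ℤ_[p]] W'.tateModule p),
      g.toAddMonoidHom.ker = L.toAddSubgroup.map (TateModule.proj p n) ∧
      (∀ (σ : absoluteGaloisGroup K) (a : W.tateModule p) (ha : a ∈ L),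
        e ⟨σ • a, hGal σ a ha⟩ = σ • e ⟨a, ha⟩) ∧
      ∀ l : L, (p : ℤ_[p]) ^ n • e l = TateModule.map p g.toAddMonoidHom (l : W.tateModule p) := by
  -- the finite `Γ_K`-stable subgroup `Φ = pr_n(L) ⊆ E[p^n]`
  set Φ : AddSubgroup W.geomPoints := L.toAddSubgroup.map (TateModule.proj p n) with hΦdef
  have hΦle : Φ ≤ geomTorsion W ((p ^ n : ℕ) : ℤ) := by
    rintro _ ⟨a, -, rfl⟩
    exact TateModule.proj_mem_torsionBy n a
  have hΦtor : ∀ P ∈ Φ, p ^ n • P = 0 := fun P hP ↦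
    AddSubgroup.torsionBy.nsmul_iff.mp (hΦle hP)
  have hΦfin : (Φ : Set W.geomPoints).Finite :=
    (finite_geomTorsion W (m := ((p ^ n : ℕ) : ℤ))
      (by exact_mod_cast (pow_pos hp.out.pos n).ne')).subset hΦle
  have hΦstab : ∀ (σ : absoluteGaloisGroup K) (P : W.geomPoints), P ∈ Φ → σ • P ∈ Φ := by
    rintro σ _ ⟨a, ha, rfl⟩
    exact ⟨σ • a, hGal σ a ha, rfl⟩
  -- membership in `L` is decided at level `n`: `L = pr_n⁻¹(Φ)`
  have hmemL : ∀ t : W.tateModule p, TateModule.proj p n t ∈ Φ → t ∈ L := by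
    rintro t ⟨l₀, hl₀, h⟩
    have h0 : TateModule.proj p n (t - l₀) = 0 := by rw [map_sub, ← h, sub_self]
    have h1 : t - l₀ ∈ L := by
      obtain ⟨b, hb⟩ := TateModule.exists_pow_smul_eq_of_proj_eq_zero (a := t - l₀) h0
      rw [← hb]
      exact hn _
    simpa using L.add_mem h1 hl₀
  -- the quotient isogeny `g : E → E' = E/Φ` and its dual `f`
  obtain ⟨W', hW', g, f, hker, hfg, hgf⟩ :=
    W.exists_isogeny_ker_eq_and_comp_eq_nsmul_holds Φ hΦfin hΦstab
  haveI := hW'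
  have hgΦ : ∀ P : W.geomPoints, g P = 0 ↔ P ∈ Φ := fun P ↦ by
    rw [← hker, AddMonoidHom.mem_ker, Isogeny.coe_toAddMonoidHom]
  -- `#Φ = p^a`
  haveI : Finite Φ := hΦfin.to_subtype
  have hPG : IsPGroup p (Multiplicative Φ) := by
    intro x
    refine ⟨n, Multiplicative.toAdd.injective ?_⟩
    rw [toAdd_pow, toAdd_one]
    exact Subtype.ext (by simpa using hΦtor _ (Multiplicative.toAdd x).2)
  obtain ⟨a, ha⟩ : ∃ a : ℕ, Nat.card (Multiplicative Φ) = p ^ a := IsPGroup.iff_card.mp hPG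
  replace ha : Nat.card Φ = p ^ a := ha
  have hgf' : ∀ Q : W'.geomPoints, g (f Q) = p ^ a • Q := fun Q ↦ by rw [hgf, ha]
  -- `E'[p^(a-n)] ⊆ ker f`
  have hfker : ∀ Q : W'.geomPoints, p ^ (a - n) • Q = 0 → f Q = 0 := by
    intro Q hQ
    obtain ⟨P, rfl⟩ := g.surjective Q
    have hP : p ^ (a - n) • P ∈ Φ := (hgΦ _).mp (by rw [map_nsmul, hQ])
    have hP' : p ^ (n + (a - n)) • P = 0 := by rw [pow_add, mul_smul]; exact hΦtor _ hP
    rcases le_or_gt n a with hna | hna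
    · rw [hfg, ha]
      rwa [Nat.add_sub_cancel' hna] at hP'
    · rw [Nat.sub_eq_zero_of_le hna.le, pow_zero, one_smul] at hQ
      rw [hQ, map_zero]
  -- the map `Θ : L → T_pE'`, `Θ(l)_k = g(l_{k+n})`
  have hΘ1 : ∀ (l : L) (k : ℕ), p ^ k • g (TateModule.proj p (k + n) (l : W.tateModule p)) = 0 := by
    intro l k
    rw [← map_nsmul, TateModule.pow_smul_proj_self_add k n]
    exact (hgΦ _).mpr ⟨l, l.2, rfl⟩
  have hΘ2 : ∀ (l : L) (k : ℕ), p • g (TateModule.proj p (k + 1 + n) (l : W.tateModule p)) =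
      g (TateModule.proj p (k + n) (l : W.tateModule p)) := by
    intro l k
    rw [← map_nsmul, show k + 1 + n = (k + n) + 1 by omega, TateModule.smul_proj_succ]
  let Θ₀ : L →+ W'.tateModule p :=
    { toFun := fun l ↦ TateModule.mk (fun k ↦ g (TateModule.proj p (k + n) (l : W.tateModule p)))
        (hΘ1 l) (hΘ2 l)
      map_zero' := TateModule.ext fun k ↦ by simp
      map_add' := fun l l' ↦ TateModule.ext fun k ↦ by simp }
  have hΘ₀ : ∀ (l : L) (k : ℕ),
      TateModule.proj p k (Θ₀ l) = g (TateModule.proj p (k + n) (l : W.tateModule p)) :=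
    fun _ _ ↦ rfl
  -- `p^n Θ = T_p(g)`
  have hΘg : ∀ l : L, (p : ℤ_[p]) ^ n • Θ₀ l = TateModule.map p g.toAddMonoidHom (l : W.tateModule p) := by
    intro l
    ext k
    rw [TateModule.proj_pow_smul, hΘ₀, TateModule.proj_map, ← map_nsmul, Isogeny.coe_toAddMonoidHom,
      TateModule.pow_smul_proj_add]
  -- `ℤ_p`-linearity (cancel `p^n`)
  let Θ : L →ₗ[ℤ_[p]] W'.tateModule p :=
    { toFun := Θ₀
      map_add' := Θ₀.map_add
      map_smul' := fun x l ↦ by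
        apply TateModule.pow_smul_right_cancel (n := n)
        rw [hΘg, Submodule.coe_smul, map_smul, ← hΘg, RingHom.id_apply, smul_comm] }
  have hΘ : ∀ (l : L) (k : ℕ),
      TateModule.proj p k (Θ l) = g (TateModule.proj p (k + n) (l : W.tateModule p)) :=
    fun _ _ ↦ rfl
  -- injective
  have hinj : Function.Injective Θ := by
    refine (injective_iff_map_eq_zero Θ).mpr fun l hl ↦ ?_
    refine Subtype.ext (TateModule.ext fun k ↦ ?_)
    have hk : g (TateModule.proj p (k + n) (l : W.tateModule p)) = 0 := by
      rw [← hΘ, hl, map_zero]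
    rw [Submodule.coe_zero, map_zero, ← TateModule.pow_smul_proj_add (l : W.tateModule p) k n]
    exact hΦtor _ ((hgΦ _).mp hk)
  -- surjective
  have hsurj : Function.Surjective Θ := by
    intro s
    -- the candidate preimage `l_k = f(p^n s_{k+a})`
    have hl1 : ∀ k : ℕ, p ^ k • f (p ^ n • TateModule.proj p (k + a) s) = 0 := by
      intro k
      rw [← map_nsmul]
      apply hfker
      obtain ⟨c, hc⟩ : ∃ c : ℕ, a - n + k + n = c + (k + a) := ⟨a - n + n - a, by omega⟩
      rw [smul_smul, ← pow_add, smul_smul, ← pow_add, hc, pow_add, mul_smul,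
        TateModule.pow_smul_proj, smul_zero]
    have hl2 : ∀ k : ℕ, p • f (p ^ n • TateModule.proj p (k + 1 + a) s) =
        f (p ^ n • TateModule.proj p (k + a) s) := by
      intro k
      rw [← map_nsmul, smul_comm, show k + 1 + a = (k + a) + 1 by omega, TateModule.smul_proj_succ]
    let l : W.tateModule p := TateModule.mk (fun k ↦ f (p ^ n • TateModule.proj p (k + a) s)) hl1 hl2
    have hlk : ∀ k, TateModule.proj p k l = f (p ^ n • TateModule.proj p (k + a) s) := fun _ ↦ rfl
    have hlL : l ∈ L := by
      apply hmemL
      rw [hlk, show n + a = a + n by omega, TateModule.pow_smul_proj_add, ← hgΦ, hgf',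
        TateModule.pow_smul_proj]
    refine ⟨⟨l, hlL⟩, TateModule.ext fun k ↦ ?_⟩
    rw [hΘ, Subtype.coe_mk, hlk, hgf', show k + n + a = (k + a) + n by omega,
      TateModule.pow_smul_proj_add, TateModule.pow_smul_proj_add]
  refine ⟨W', hW', g, LinearEquiv.ofBijective Θ ⟨hinj, hsurj⟩, hker, ?_, ?_⟩
  · intro σ t ht
    refine TateModule.ext fun k ↦ ?_
    rw [LinearEquiv.ofBijective_apply, LinearEquiv.ofBijective_apply, hΘ, Subtype.coe_mk,
      TateModule.proj_smul_of_distribMulAction, TateModule.proj_smul_of_distribMulAction, hΘ,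
      Isogeny.map_smul]
  · intro l
    rw [LinearEquiv.ofBijective_apply]
    exact hΘg l

end Construction

/-! ## Over `ℚ`: the member may be taken globally minimal -/

section Rat

variable (W : WeierstrassCurve ℚ) [W.IsElliptic] (p : ℕ) [hp : Fact p.Prime]

/-- `T_p` of a bijective isogeny (e.g. an isomorphism = admissible change of variables,
Silverman *AEC* III.3.1(b)) is a `Γ`-equivariant `ℤ_p`-linear isomorphism of Tate modules
(functoriality of `T_p`, *AEC* III.§7: "`φ : E₁ → E₂` induces `φ_ℓ : T_ℓ(E₁) → T_ℓ(E₂)`", applied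
to `φ` and `φ⁻¹`). [cite: SilvermanAEC2009, III.7 (the map `φ_ℓ`, before Thm. III.7.4) and III.3.1(b)] -/
theorem exists_tateModule_equiv_of_isogeny_bijective {K : Type u} [Field K]
    {W₁ W₂ : WeierstrassCurve K} (p : ℕ) [Fact p.Prime] (ι : Isogeny W₁ W₂)
    (hι : Function.Bijective ι) :
    ∃ e : W₁.tateModule p ≃ₗ[ℤ_[p]] W₂.tateModule p,
      (∀ t, e t = TateModule.map p ι.toAddMonoidHom t) ∧
      ∀ (σ : absoluteGaloisGroup K) (t : W₁.tateModule p), e (σ • t) = σ • e t := by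
  let ιe : W₁.geomPoints ≃+ W₂.geomPoints := AddEquiv.ofBijective ι.toAddMonoidHom hι
  have hιe : ∀ P, ιe P = ι P := fun _ ↦ rfl
  have hinj : Function.Injective (TateModule.map p ι.toAddMonoidHom) := by
    refine (injective_iff_map_eq_zero _).mpr fun t ht ↦ TateModule.ext fun k ↦ ?_
    have := congrArg (TateModule.proj p k) ht
    rw [TateModule.proj_map, map_zero, Isogeny.coe_toAddMonoidHom] at this
    rw [map_zero]
    exact hι.1 (by rw [this, map_zero])
  have hsurj : Function.Surjective (TateModule.map p ι.toAddMonoidHom) := by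
    intro s
    refine ⟨TateModule.map p ιe.symm.toAddMonoidHom s, TateModule.ext fun k ↦ ?_⟩
    rw [TateModule.proj_map, TateModule.proj_map, AddEquiv.coe_toAddMonoidHom,
      Isogeny.coe_toAddMonoidHom, ← hιe, AddEquiv.apply_symm_apply]
  refine ⟨LinearEquiv.ofBijective _ ⟨hinj, hsurj⟩, fun t ↦ rfl, fun σ t ↦ TateModule.ext fun k ↦ ?_⟩
  rw [LinearEquiv.ofBijective_apply, LinearEquiv.ofBijective_apply, TateModule.proj_map,
    TateModule.proj_smul_of_distribMulAction, TateModule.proj_smul_of_distribMulAction,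
    TateModule.proj_map, Isogeny.coe_toAddMonoidHom, Isogeny.map_smul]

/-- **Kato's member exists, globally minimal.** For an elliptic curve `E/ℚ`, a prime `p` and a
`Γ_ℚ`-stable `ℤ_p`-submodule `L ⊆ T_pE` containing `p^nT_pE`, there is a GLOBALLY MINIMAL elliptic
curve `E'/ℚ`, `ℚ`-isogenous to `E`, with a `Γ_ℚ`-equivariant `ℤ_p`-linear isomorphism `L ≅ T_pE'`
(the quotient `E/pr_n(L)` of Silverman *AEC* III.4.12 / Rem. III.4.13.2, moved to a global minimal
model by *AEC* VIII.8.3). Applied to `L` = (a `p`-power multiple of) Kato's lattice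
`V_{ℤ_p}(f)(1) ⊂ V_pE` (Astérisque 295, 8.3 / 17.5) this is the existence of the member `E_K` of
the isogeny class with `T_pE_K ≅ V_{ℤ_p}(f)(1)` (Wuthrich 2014 §3.2).
[cite: SilvermanAEC2009, Prop. III.4.12 with Rem. III.4.13.2, III.7 and Cor. VIII.8.3]
[cite: Kato2004Asterisque, 8.3 (p. 181) and 17.5 (p. 274)] [cite: Wuthrich2014, §3.2 (p. 394)] -/
theorem _root_.WeierstrassCurve.exists_isIsogenous_isGloballyMinimal_tateModule_equiv_of_stableLattice
    (L : Submodule ℤ_[p] (W.tateModule p))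
    (hGal : ∀ (σ : absoluteGaloisGroup ℚ) (a : W.tateModule p), a ∈ L → σ • a ∈ L)
    {n : ℕ} (hn : ∀ a : W.tateModule p, (p : ℤ_[p]) ^ n • a ∈ L) :
    ∃ (W' : WeierstrassCurve ℚ) (_ : W'.IsElliptic) (_ : W'.IsGloballyMinimal)
      (e : L ≃ₗ[ℤ_[p]] W'.tateModule p),
      IsIsogenous W W' ∧
      ∀ (σ : absoluteGaloisGroup ℚ) (a : W.tateModule p) (ha : a ∈ L),
        e ⟨σ • a, hGal σ a ha⟩ = σ • e ⟨a, ha⟩ := by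
  obtain ⟨W₁, hW₁, g, e₁, -, he₁, -⟩ :=
    W.exists_isogeny_tateModule_equiv_of_stableLattice p L hGal hn
  haveI := hW₁
  obtain ⟨C, hC⟩ := hasGlobalMinimalModel_rat_holds W₁
  obtain ⟨e₂, -, he₂⟩ := exists_tateModule_equiv_of_isogeny_bijective p (VariableChange.toIsogeny W₁ C)
    ⟨VariableChange.toIsogeny_injective W₁ C, VariableChange.toIsogeny_surjective W₁ C⟩
  refine ⟨C • W₁, inferInstance, hC, e₁.trans e₂, IsIsogenous.trans' ⟨g⟩ (isIsogenous_smul W₁ C),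
    fun σ a ha ↦ ?_⟩
  rw [LinearEquiv.trans_apply, LinearEquiv.trans_apply, he₁, he₂]

end Rat

end Literature.NumberTheory.EllipticCurves

end
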